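import Summits.Ventures.YMGap.RobustBall.MassGapOnBallZdWNumerics
import Mathlib.Analysis.Complex.ExponentialBounds
import HarnessLib

/-!
# Venture YMGap, track ROBUST-BALL (Y2) — crux Y2-X2-WZd: numeric majorants of the tier-2 `ℤ^d` cells at the SMALL
# WEIGHT `κ = 1/100` (box radius `D = 1000`, rate `t = 10⁻⁶`)

HONEST FRAMING. WHAT THIS IS: a venture file (cell `pub-ymgap`, track Y2 ROBUST-BALL, seat ds-2) of elementary real
inequalities for the far factors of the tier-2 `ℤ^d` star door at weight `κ = 1/100`: a member of `MemBallZdW (1/100) ε₀ ε₁`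
(loads weighted by `e^{diam/100}` — essentially unweighted up to diameter `≈ 100`) has far loads `≤ (d+1)e^{−10}ε₁` outside the
radius-`1000` box, `e^{−10} ≤ 1/22026` (`Real.exp_one_gt_d9`), and at rate `t = 10⁻⁶` the near inflation is
`e^{t(2D+3)} ≤ 1.0021`; by `MassGapOnBallZdW.of_weight_le` a row at `κ = 1/100` is a row at EVERY `κ ≥ 1/100`.
WHAT THIS IS NOT: no lattice content; nothing about the continuum or the Millennium problem.
-/

noncomputable section

open Finset Real

namespace Summit.Ventures.YMGap.RobustBall

/-- `e^{−(1/100)·1000} = e^{−10} ≤ 1/22026` (`e ≥ 2.7182818283`). [folklore] -/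
theorem exp_neg_k100_D1000_le : Real.exp (-(1 / 100 * ((1000 : ℕ) : ℝ))) ≤ 1 / 22026 := by
  have h10 : (1 / 100 : ℝ) * ((1000 : ℕ) : ℝ) = (10 : ℕ) * 1 := by norm_num
  rw [h10, Real.exp_neg, Real.exp_nat_mul, one_div]
  have he : (2.7182818283 : ℝ) ^ 10 ≤ Real.exp 1 ^ 10 := pow_le_pow_left₀ (by norm_num) Real.exp_one_gt_d9.le 10
  have hpos : (0 : ℝ) < Real.exp 1 ^ 10 := by positivity
  rw [inv_le_inv₀ hpos (by norm_num)]
  exact le_trans (by norm_num) he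

/-- `e^{t(2D+3)} ≤ 1.0021` at `D = 1000`, `t = 10⁻⁶`. [folklore] -/
theorem exp_le_A1_k100 : Real.exp (1 / 1000000 * (((max (2 * 1000) 1 + 2 : ℕ) : ℝ) + 1)) ≤ 10021 / 10000 := by
  have : (((max (2 * 1000) 1 + 2 : ℕ) : ℝ) + 1) = 2003 := by norm_num
  rw [this]
  exact (RobustBallPair.exp_le_one_add_add_sq (by norm_num) (by norm_num)).trans (by norm_num)

/-- `e^{2t} ≤ 1.000003` at `t = 10⁻⁶`. [folklore] -/
theorem exp_two_t_k100 : Real.exp (2 * (1 / 1000000 : ℝ)) ≤ 1000003 / 1000000 :=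
  (RobustBallPair.exp_le_one_add_add_sq (by norm_num) (by norm_num)).trans (by norm_num)

/-- The far factor at `κ = 1/100`, `D = 1000`, `t = 10⁻⁶`: `e^{2t} e^{−(κ−t)D} ≤ 1.000003·(e^{−10}·e^{1/1000}) ≤
1.000003·((1/22026)·1.0011)`. [folklore] -/
theorem exp_far_k100 : Real.exp (2 * (1 / 1000000 : ℝ)) * Real.exp (-((1 / 100 - 1 / 1000000) * ((1000 : ℕ) : ℝ))) ≤
    (1000003 / 1000000) * ((1 / 22026) * (10011 / 10000)) := by
  have h2 : Real.exp (-((1 / 100 - 1 / 1000000) * ((1000 : ℕ) : ℝ))) =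
      Real.exp (-(1 / 100 * ((1000 : ℕ) : ℝ))) * Real.exp ((1 / 1000000 : ℝ) * 1000) := by
    rw [← Real.exp_add]; congr 1; push_cast; ring
  have h3 : Real.exp ((1 / 1000000 : ℝ) * 1000) ≤ 10011 / 10000 :=
    (RobustBallPair.exp_le_one_add_add_sq (by norm_num) (by norm_num)).trans (by norm_num)
  rw [h2]
  exact mul_le_mul exp_two_t_k100 (mul_le_mul exp_neg_k100_D1000_le h3 (by positivity) (by norm_num)) (by positivity)
    (by norm_num)

end Summit.Ventures.YMGap.RobustBall

end
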